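import Literature.MathematicalPhysics.QuantumFieldTheory.Balaban1983to89.QGQInverse
import Literature.MathematicalPhysics.QuantumFieldTheory.Balaban1983to89.B11Reparam190

/-!
# Bałaban, *Propagators for lattice gauge theories in a background field*, Commun. Math. Phys. **99** (1985) 389–434, p. 422
# (3.132) — the (3.132)-SHAPE block majorant of `(QG₀Q*)⁻¹` FROM the block majorant of `QG₀Q*` (⇐ Thm 3.3 for `G₀`) AND A
# COERCIVITY BOUND `QG₀Q* ≥ γ`, by the finite Combes–Thomas mechanism of `QGQInverse.inverse_decay` — the row's letter `hInv₀`
# in the block-majorant currency of [15] Sect. G (`B11SectG.HasMaj`)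

CITATION HEADER (lean-in-tree rule 2026-08-18).  Source: T. Bałaban, Commun. Math. Phys. **99** (1985) 389–434
[Balaban1985BackgroundPropagators] (cell paper B9 = [5] of the consumer [15]; held `paper:balaban1985-cmp99-background-propagators`,
journal page = PDF page + 388), p. 422 before Thm 3.12 (quoted by `QGQInverse`'s header from the render `…-p034-x2.png`): *"(QGQ*)^{−1}
… can be analyzed in the same way as the operator (Q′G′²Q′*)^{−1}. We will not repeat these considerations here. Let us write only
bounds. We have |(QGQ*)^{−1}(y, y′)| ≤ O(1)(L^jη)^{−2}(L^{j′}η)^{−d}e^{−δ₁d(y,y′)} (3.132)"* (cell GAPS G-B9-15; for the `Δ_a⁻¹` of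
[15]: G-IF-02 — *"a (3.132)-type bound for (QG₀Q*)⁻¹, G₀ = Δ_a⁻¹ … is printed nowhere"*); Thm 3.3 p. 399 with (3.42) p. 397; the
consumer T. Bałaban, Commun. Math. Phys. **102** (1985) 277–309 [Balaban1985Variational] (129)–(130) p. 297; [3] = Commun. Math.
Phys. **96** (1984) 223–250 [Balaban1984PropagatorsII] (2.51)–(2.56) pp. 232–233, Lemma 2.1 (2.61) p. 234.  Mechanism: J.-M. Combes,
L. Thomas, Commun. Math. Phys. **34** (1973) 251–270 [CombesThomas1973] §II, in the finite form kernel-checked by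
`QGQInverse.inverse_decay` (unit `b2b-balaban-r1`, with the written repair `HOME/b2b-balaban-r1/QGQ-inverse-proof.md`).

WHY THIS FILE (audit cell `pub-balaban`, BINDER row (D4), OWNER lineage `b2b-balaban-beta-an4`, gen 106).  After
`Beta.RemainderOriginBaseLetters` (gen 105), `Beta.RemainderInvQGQNewG` and `Beta.RemainderOriginTwoLetters` (gen 106) the (190)
letter of the row's NODE D at the origin in a background rests on TWO analytic letters of [5]-shape: `hG0` (Thm 3.3 (3.42), first
entry, for `G₀ = Δ_a⁻¹`) and `hInv₀` — a block majorant `B_Ie^{−δ_Id}` of `(QG₀Q*)⁻¹` between the two `Q`-sizes (the SHAPE of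
(3.132)).  THIS FILE reduces `hInv₀`, on a concrete real carrier with the sharp-block sup sizes `B11SectG.BlockNorm.ofBlocks`, to
**the block majorant of `QG₀Q*` itself** (which `hG0` and the locality of `Q`, `Q*` give by `B11Reparam190.hasMaj_comp_localLeft`
∕ `…Right` — §4) **and ONE coercivity constant `γ > 0` of `QG₀Q*`** (`QGQInverse.Coercive`; the written repair obtains it from an
energy bound for explicit test fields through `QGQInverse.qgq_coercive_of_approx_right_inverse` — NOT proved here), by:
* §1 `exp_weight_le` (private): the elementary weight bound `e^{−δt}(e^{κt} − 1) ≤ (κ/τ)e^{−(δ−κ−τ)t}` (`t ≥ 0`, `κ ≥ 0`, `τ > 0`), and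
  `abs_entry_le_of_hasMaj`: a block majorant `K ≥ 0` between the sharp-block sup sizes bounds every matrix entry,
  `|S(i,j)| ≤ K(blk i, blk j)`.
* §2 **`weightedRowSum_le`**: entries `|S(i,j)| ≤ Ce^{−δd(blk i, blk j)}`, at most `N` indices per block, the row sum (2.61) of
  Lemma 2.1 [3] at the rate `σ` with constant `c`, and `κ + τ + σ ≤ δ` ⟹ the Combes–Thomas weighted row sums of `QGQInverse.inverse_decay`
  are `≤ ρ := Cκτ⁻¹Nc` — SMALL WITH `κ`; columns alike (`weightedColSum_le`, distance symmetric).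
* §3 **`hasMaj_inv_of_coercive_decay`**: `S` `γ`-coercive with those entries and `ρ < γ` ⟹ `S⁻¹` has the block majorant
  `N(γ − ρ)⁻¹e^{−κd}` between the sharp-block sup sizes (`QGQInverse.inverse_decay` for the entries, then the block count) — the
  `hInv₀` letter with `B_I = N(γ − ρ)⁻¹`, `δ_I = κ`; **`hasMaj_inv_of_coercive_hasMaj`**: the same with the entry decay read off a
  block majorant `Ce^{−δd}` of `S` (§1).
* §4 **`hasMaj_qgq_of_letters`**: the block majorant `κ₃·(κ_NBν_Qe^{δ₁r_Q})·ν_{Q*}e^{δ₁r_Q}·e^{−δ₁d}` of `QG₀Q*` from `hG0` and the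
  locality of `Q`, `Q*` (abstract block-normed spaces; no rate lost).
* §5 **`hasMaj_invQGQ_of_coercive`**: the composition — `hInv₀` (majorant `N(γ − ρ)⁻¹e^{−κd}` of `(toMatrix′(QG₀Q*))⁻¹`) from `hG0`,
  `Q` ∕ `Q*` local, at most `N` indices per block, and `Coercive (toMatrix′(QG₀Q*)) γ` with `ρ = C_Sκτ⁻¹Nc < γ`.
After this file the analytic letters of NODE D at the origin in a background read: `hG0` = [5] Thm 3.3 (3.42), first entry, for the
bond operator `Δ_a⁻¹` in the background, and a coercivity constant of `QG₀Q*` — everything else structural or a smallness.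

HONEST SCOPE.  [folklore] finite linear algebra over the cell's kernel-checked Combes–Thomas lemma (`QGQInverse.inverse_decay`, r1) and
the block-majorant vocabulary of `B11SectG`; NO estimate of [5] or [15] is proved: Thm 3.3 and the coercivity of `QG₀Q*` in a
background field stay hypotheses; the carrier is ONE real index set with sharp blocks (the weights `(L^jη)^{−2}(L^{j′}η)^{−d}` of
(3.132) and the multiscale normalisation of the written repair are NOT reproduced — single-scale ∕ unweighted currency, as in the row's
finite-carrier ENDs); nothing identifies Bałaban's step-`k` operators with tree terms (NODE O); constants and rates are this file's,
absorbed in print's *"O(1)"*, *"δ₁"* (cell DIVERGENCE D-r1.2).  Row (D4) class UNCHANGED (instance 0∕1; D4 DISCHARGE NO DATE); NOT B12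
Thm 2, NOT BetaPertH, NOT continuum, NOT Clay.  HONEST DEPENDENCY (cell line): continuum YM on T⁴ ⇐ BetaPertH ∧ nine spine estimates
(0/9 proved); BetaPertH ⇐ (D1) ∧ (D4) ∧ CAP+tail; G-an2-4 gates asym, D1 and NE2/3/4.  NEW file importing `QGQInverse` + `B11Reparam190`
(both built); nothing modified; 0 `def`; standard axioms; no `sorry`.
-/

namespace Literature.MathematicalPhysics.QuantumFieldTheory.Balaban1983to89.Beta.RemainderInvQGQCoercive

open Literature.MathematicalPhysics.QuantumFieldTheory.Balaban1983to89
open Finset Matrix B6RandomWalk B11SectG B11Reparam190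

variable {g : B6.Geometry}

/-! ## §1  Two elementary dictionary lemmas -/

/-- The Combes–Thomas weight against an exponentially decaying entry: for `t ≥ 0`, `κ ≥ 0`, `τ > 0`,
`e^{−δt}(e^{κt} − 1) ≤ (κ/τ)·e^{−(δ−κ−τ)t}` (`e^{κt} − 1 ≤ κte^{κt}` and `τt ≤ e^{τt}`; both sides make sense for every real `t`). [folklore] -/
private theorem exp_weight_le {δ κ τ t : ℝ} (hκ : 0 ≤ κ) (hτ : 0 < τ) :
    Real.exp (-(δ * t)) * (Real.exp (κ * t) - 1) ≤ κ / τ * Real.exp (-((δ - κ - τ) * t)) := by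
  -- e^{x} − 1 ≤ x e^{x} for x = κt ≥ 0 (from 1 − x ≤ e^{−x})
  have h1 : Real.exp (κ * t) - 1 ≤ κ * t * Real.exp (κ * t) := by
    have h := Real.add_one_le_exp (-(κ * t))
    have hpos := Real.exp_pos (κ * t)
    have hprod : Real.exp (κ * t) * Real.exp (-(κ * t)) = 1 := by rw [← Real.exp_add, add_neg_cancel, Real.exp_zero]
    nlinarith [mul_le_mul_of_nonneg_left h hpos.le]
  -- τt ≤ e^{τt}
  have h2 : τ * t ≤ Real.exp (τ * t) := by linarith [Real.add_one_le_exp (τ * t)]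
  have h3 : t ≤ Real.exp (τ * t) / τ := by
    rw [le_div_iff₀ hτ]; linarith
  have hκt : 0 ≤ κ * Real.exp (κ * t) := mul_nonneg hκ (Real.exp_pos _).le
  calc Real.exp (-(δ * t)) * (Real.exp (κ * t) - 1)
      ≤ Real.exp (-(δ * t)) * (κ * t * Real.exp (κ * t)) :=
        mul_le_mul_of_nonneg_left h1 (Real.exp_pos _).le
    _ = (κ * Real.exp (κ * t)) * Real.exp (-(δ * t)) * t := by ring
    _ ≤ (κ * Real.exp (κ * t)) * Real.exp (-(δ * t)) * (Real.exp (τ * t) / τ) :=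
        mul_le_mul_of_nonneg_left h3 (mul_nonneg hκt (Real.exp_pos _).le)
    _ = κ / τ * (Real.exp (κ * t) * Real.exp (-(δ * t)) * Real.exp (τ * t)) := by ring
    _ = κ / τ * Real.exp (-((δ - κ - τ) * t)) := by
        rw [← Real.exp_add, ← Real.exp_add]; congr 1; ring_nf

section Entries

variable {n : Type} [Fintype n] [DecidableEq n]

/-- **A block majorant bounds every entry.**  If the matrix `S` (as the operator `S.toLin'` on `n → ℝ`) has the majorant
`K ≥ 0` between the sharp-block sup sizes of the block map `blk` (`B11SectG.BlockNorm.ofBlocks`: *"(size of Sμ near y) ≤ K(y,y′)·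
(size of μ), μ localised near y′"* — the shape of [3] (2.51)), then `|S(i,j)| ≤ K(blk i, blk j)` (test on the indicator of `j`).
[cite: Balaban1984PropagatorsII, (2.51)–(2.52) p.232] -/
theorem abs_entry_le_of_hasMaj (blk : n → g.Site) (S : Matrix n n ℝ) {K : g.Site → g.Site → ℝ}
    (hK : ∀ a b, 0 ≤ K a b)
    (h : HasMaj (BlockNorm.ofBlocks g blk) (BlockNorm.ofBlocks g blk) (Matrix.toLin' S) K) (i j : n) :
    |S i j| ≤ K (blk i) (blk j) := by
  classical
  set μ : n → ℝ := Pi.single j (1 : ℝ) with hμ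
  have hloc : (BlockNorm.ofBlocks g blk).IsLoc (blk j) μ := by
    intro x hx
    have hxj : x ≠ j := fun e => hx (by rw [e])
    simp [hμ, hxj]
  have hle := h (blk j) μ hloc (blk i)
  -- the size of μ at blk j is ≤ 1
  have hμsize : (BlockNorm.ofBlocks g blk).loc (blk j) μ ≤ 1 := by
    show (⨆ x : n, if blk x = blk j then |μ x| else 0) ≤ 1
    haveI : Nonempty n := ⟨j⟩
    refine ciSup_le fun x => ?_
    by_cases hx : blk x = blk j
    · simp only [hx, if_true, hμ, Pi.single_apply]
      split_ifs <;> simp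
    · simp [hx]
  -- the size of Sμ at blk i dominates |(Sμ) i| = |S i j|
  have hSij : |S i j| ≤ (BlockNorm.ofBlocks g blk).loc (blk i) (Matrix.toLin' S μ) := by
    show |S i j| ≤ ⨆ x : n, if blk x = blk i then |Matrix.toLin' S μ x| else 0
    have hval : Matrix.toLin' S μ i = S i j := by
      rw [Matrix.toLin'_apply, hμ]; exact QGQInverse.mulVec_single_one_apply S i j
    refine le_trans ?_ (le_ciSup (Finite.bddAbove_range _) i)
    simp [hval]
  calc |S i j| ≤ (BlockNorm.ofBlocks g blk).loc (blk i) (Matrix.toLin' S μ) := hSij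
    _ ≤ K (blk i) (blk j) * (BlockNorm.ofBlocks g blk).loc (blk j) μ := hle
    _ ≤ K (blk i) (blk j) * 1 :=
        mul_le_mul_of_nonneg_left hμsize (hK _ _)
    _ = K (blk i) (blk j) := mul_one _

end Entries

/-! ## §2  The Combes–Thomas weighted row sums are small with the rate `κ` -/

section RowSums

variable {n : Type} [Fintype n] [DecidableEq n]

omit [DecidableEq n] in
/-- **WEIGHTED ROW SUMS.**  Entries `|S(i,j)| ≤ Ce^{−δd(blk i, blk j)}` (`C ≥ 0`), at most `N` indices in every block, the
distance `d ≥ 0`, the row sum (2.61) of Lemma 2.1 [3] at the rate `σ` with constant `c`, and rates `κ ≥ 0`, `τ > 0` with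
`κ + τ + σ ≤ δ`: then `Σ_j |S(i,j)|(e^{κd(blk i, blk j)} − 1) ≤ Cκτ⁻¹·N·c` for every `i` — the input `hrow` of
`QGQInverse.inverse_decay`, small with `κ`. [cite: Balaban1984PropagatorsII, Lemma 2.1 (2.61) p.234; CombesThomas1973, §II] -/
theorem weightedRowSum_le (blk : n → g.Site) (S : Matrix n n ℝ) {C δ κ τ σ c : ℝ} {N : ℕ}
    (hd : ∀ a b : g.Site, 0 ≤ g.dist a b) (hrow : RowSum g σ c) (hC : 0 ≤ C) (hκ : 0 ≤ κ) (hτ : 0 < τ)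
    (hrate : κ + τ + σ ≤ δ) (hN : ∀ y : g.Site, ∃ s : Finset n, s.card ≤ N ∧ ∀ j, blk j = y → j ∈ s)
    (hS : ∀ i j, |S i j| ≤ C * Real.exp (-(δ * g.dist (blk i) (blk j)))) (i : n) :
    ∑ j, |S i j| * (Real.exp (κ * g.dist (blk i) (blk j)) - 1) ≤ C * κ / τ * N * c := by
  classical
  -- termwise: |S i j|(e^{κd} − 1) ≤ C(κ/τ)e^{−σd}
  have hterm : ∀ j, |S i j| * (Real.exp (κ * g.dist (blk i) (blk j)) - 1) ≤
      C * (κ / τ) * Real.exp (-(σ * g.dist (blk i) (blk j))) := by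
    intro j
    set t := g.dist (blk i) (blk j) with ht
    have ht0 : 0 ≤ t := hd _ _
    have hw0 : 0 ≤ Real.exp (κ * t) - 1 := by
      have := Real.exp_le_exp.mpr (mul_nonneg hκ ht0); rw [Real.exp_zero] at this; linarith
    calc |S i j| * (Real.exp (κ * t) - 1) ≤ C * Real.exp (-(δ * t)) * (Real.exp (κ * t) - 1) :=
          mul_le_mul_of_nonneg_right (hS i j) hw0
      _ = C * (Real.exp (-(δ * t)) * (Real.exp (κ * t) - 1)) := by ring
      _ ≤ C * (κ / τ * Real.exp (-((δ - κ - τ) * t))) := mul_le_mul_of_nonneg_left (exp_weight_le hκ hτ) hC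
      _ ≤ C * (κ / τ * Real.exp (-(σ * t))) := by
          refine mul_le_mul_of_nonneg_left (mul_le_mul_of_nonneg_left ?_ (div_nonneg hκ hτ.le)) hC
          exact Real.exp_le_exp.mpr (by nlinarith)
      _ = C * (κ / τ) * Real.exp (-(σ * t)) := by ring
  -- sum over j, fibre by fibre over the blocks
  have hfib : ∑ j, Real.exp (-(σ * g.dist (blk i) (blk j))) ≤ N * c := by
    have e : ∑ j, Real.exp (-(σ * g.dist (blk i) (blk j))) =
        ∑ y : g.Site, ∑ j ∈ univ.filter (fun j : n => blk j = y), Real.exp (-(σ * g.dist (blk i) y)) := by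
      rw [Finset.sum_fiberwise' univ blk fun y => Real.exp (-(σ * g.dist (blk i) y))]
    rw [e]
    calc ∑ y : g.Site, ∑ j ∈ univ.filter (fun j : n => blk j = y), Real.exp (-(σ * g.dist (blk i) y))
        = ∑ y : g.Site, ((univ.filter fun j : n => blk j = y).card : ℝ) * Real.exp (-(σ * g.dist (blk i) y)) := by
          refine Finset.sum_congr rfl fun y _ => ?_
          rw [Finset.sum_const, nsmul_eq_mul]
      _ ≤ ∑ y : g.Site, (N : ℝ) * Real.exp (-(σ * g.dist (blk i) y)) := by
          refine Finset.sum_le_sum fun y _ => mul_le_mul_of_nonneg_right ?_ (Real.exp_nonneg _)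
          obtain ⟨s, hs, hmem⟩ := hN y
          have hsub : (univ.filter fun j : n => blk j = y) ⊆ s := fun j hj => hmem j (Finset.mem_filter.1 hj).2
          exact_mod_cast (Finset.card_le_card hsub).trans hs
      _ = N * ∑ y : g.Site, Real.exp (-(σ * g.dist (blk i) y)) := by rw [Finset.mul_sum]
      _ ≤ N * c := mul_le_mul_of_nonneg_left (hrow (blk i)) (Nat.cast_nonneg N)
  calc ∑ j, |S i j| * (Real.exp (κ * g.dist (blk i) (blk j)) - 1)
      ≤ ∑ j, C * (κ / τ) * Real.exp (-(σ * g.dist (blk i) (blk j))) := Finset.sum_le_sum fun j _ => hterm j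
    _ = C * (κ / τ) * ∑ j, Real.exp (-(σ * g.dist (blk i) (blk j))) := by rw [Finset.mul_sum]
    _ ≤ C * (κ / τ) * (N * c) := mul_le_mul_of_nonneg_left hfib (mul_nonneg hC (div_nonneg hκ hτ.le))
    _ = C * κ / τ * N * c := by ring

omit [DecidableEq n] in
/-- The same for the COLUMN sums (the entry bound is symmetric in shape; the distance symmetric).
[cite: Balaban1984PropagatorsII, Lemma 2.1 (2.61) p.234; CombesThomas1973, §II] -/
theorem weightedColSum_le (blk : n → g.Site) (S : Matrix n n ℝ) {C δ κ τ σ c : ℝ} {N : ℕ}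
    (hd : ∀ a b : g.Site, 0 ≤ g.dist a b) (hds : ∀ a b : g.Site, g.dist a b = g.dist b a) (hrow : RowSum g σ c)
    (hC : 0 ≤ C) (hκ : 0 ≤ κ) (hτ : 0 < τ) (hrate : κ + τ + σ ≤ δ)
    (hN : ∀ y : g.Site, ∃ s : Finset n, s.card ≤ N ∧ ∀ j, blk j = y → j ∈ s)
    (hS : ∀ i j, |S i j| ≤ C * Real.exp (-(δ * g.dist (blk i) (blk j)))) (j : n) :
    ∑ i, |S i j| * (Real.exp (κ * g.dist (blk i) (blk j)) - 1) ≤ C * κ / τ * N * c := by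
  -- apply the row-sum bound to the transpose
  have hT : ∀ i k, |Sᵀ i k| ≤ C * Real.exp (-(δ * g.dist (blk i) (blk k))) := by
    intro i k; rw [Matrix.transpose_apply, hds]; exact hS k i
  have h := weightedRowSum_le blk Sᵀ hd hrow hC hκ hτ hrate hN hT j
  refine le_trans (le_of_eq (Finset.sum_congr rfl fun i _ => ?_)) h
  rw [Matrix.transpose_apply, hds]

end RowSums

/-! ## §3  `hInv₀` from the entry decay of `QG₀Q*` and a coercivity constant -/

section Inverse

variable {n : Type} [Fintype n] [DecidableEq n]

/-- **THE (3.132)-SHAPE BLOCK MAJORANT OF `S⁻¹` FROM COERCIVITY AND ENTRY DECAY** (the finite Combes–Thomas mechanism of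
`QGQInverse.inverse_decay`, read into the block-majorant currency of [15] Sect. G).  `S` a real matrix over the finite index set `n`
(= the coarse sites × colour components carrying `QG₀Q*`), `blk : n → 𝔅` its block map with at most `N` indices per block, the
distance of `𝔅` a pseudo-metric (`d ≥ 0`, symmetric, `d(y,y) = 0`, (2.54)), the row sum (2.61) at the rate `σ` with constant `c`;
HYPOTHESES OF SUBSTANCE: `S` is `γ`-coercive (`γ‖x‖² ≤ ⟨x,Sx⟩` — for `QG₀Q*` in a background the content of the written repair's
Lemma P′ ∕ `QGQInverse.qgq_coercive_of_approx_right_inverse`) and has the entries `|S(i,j)| ≤ Ce^{−δd(blk i, blk j)}` (⇐ [5] Thm 3.3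
for `G₀` + `Q`, `Q*` local, §4 + §1).  CONCLUSION: for rates `κ ≥ 0`, `τ > 0` with `κ + τ + σ ≤ δ` and `ρ := Cκτ⁻¹Nc < γ`, the
operator `S⁻¹` has the block majorant `N(γ − ρ)⁻¹·e^{−κd(y,y′)}` between the sharp-block sup sizes — the row's letter `hInv₀` with
`B_I = N(γ − ρ)⁻¹`, `δ_I = κ` (any `κ < min(δ − σ, γτ(CNc)⁻¹)` will do: the rate of (3.132) is born here).
[cite: Balaban1985BackgroundPropagators, (3.132) p.422, Thm 3.3 p.399; Balaban1985Variational, (129)–(130) p.297; Balaban1984PropagatorsII, (2.51)–(2.54) pp.232–233, Lemma 2.1 (2.61) p.234; CombesThomas1973, §II] -/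
theorem hasMaj_inv_of_coercive_decay (blk : n → g.Site) (S : Matrix n n ℝ) {γ C δ κ τ σ c ρ : ℝ} {N : ℕ}
    (hd : ∀ a b : g.Site, 0 ≤ g.dist a b) (hds : ∀ a b : g.Site, g.dist a b = g.dist b a)
    (hd0 : ∀ a : g.Site, g.dist a a = 0) (htri : Triangle254 g) (hrow : RowSum g σ c)
    (hC : 0 ≤ C) (hκ : 0 ≤ κ) (hτ : 0 < τ) (hrate : κ + τ + σ ≤ δ)
    (hN : ∀ y : g.Site, ∃ s : Finset n, s.card ≤ N ∧ ∀ j, blk j = y → j ∈ s)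
    (hco : QGQInverse.Coercive S γ) (hS : ∀ i j, |S i j| ≤ C * Real.exp (-(δ * g.dist (blk i) (blk j))))
    (hρ : ρ = C * κ / τ * N * c) (hργ : ρ < γ) :
    HasMaj (BlockNorm.ofBlocks g blk) (BlockNorm.ofBlocks g blk) (Matrix.toLin' S⁻¹)
      (fun a b => N * (γ - ρ)⁻¹ * Real.exp (-(κ * g.dist a b))) := by
  -- the entries of S⁻¹ (QGQInverse.inverse_decay with the block distance as pseudo-metric on n)
  have hent : ∀ i j, |S⁻¹ i j| ≤ (γ - ρ)⁻¹ * Real.exp (-(κ * g.dist (blk i) (blk j))) := by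
    intro i j
    refine QGQInverse.inverse_decay S (fun a b => g.dist (blk a) (blk b)) hργ hκ hco (fun a b => hds _ _) (fun a => hd0 _)
      (fun a b e => htri _ _ _) (fun a => ?_) (fun b => ?_) i j
    · rw [hρ]; exact weightedRowSum_le blk S hd hrow hC hκ hτ hrate hN hS a
    · rw [hρ]; exact weightedColSum_le blk S hd hds hrow hC hκ hτ hrate hN hS b
  have hγρ : 0 ≤ (γ - ρ)⁻¹ := inv_nonneg.mpr (by linarith)
  -- block majorant: sum the entries over the (at most N) indices of the source block
  refine hasMaj_of_hasMajorant blk (fun a b => mul_nonneg (mul_nonneg (Nat.cast_nonneg N) hγρ) (Real.exp_nonneg _)) ?_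
  intro y' μ B hμ x
  rw [Matrix.toLin'_apply]
  obtain ⟨s, hs, hmem⟩ := hN y'
  have hB : 0 ≤ B := hμ.nonneg
  -- the sum defining (S⁻¹μ)(x) lives on s ⊇ the block of y′
  have e : (S⁻¹ *ᵥ μ) x = ∑ j ∈ s, S⁻¹ x j * μ j := by
    rw [Matrix.mulVec, dotProduct]
    refine (Finset.sum_subset (Finset.subset_univ s) fun j _ hj => ?_).symm
    have hjy : blk j ≠ y' := fun e => hj (hmem j e)
    rw [hμ.off j hjy, mul_zero]
  have hterm : ∀ j ∈ s, |S⁻¹ x j * μ j| ≤ (γ - ρ)⁻¹ * Real.exp (-(κ * g.dist (blk x) y')) * B := by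
    intro j _
    by_cases hjy : blk j = y'
    · rw [abs_mul, ← hjy]
      exact mul_le_mul (hent x j) (hμ.bound j hjy) (abs_nonneg _) (mul_nonneg hγρ (Real.exp_nonneg _))
    · rw [hμ.off j hjy, mul_zero, abs_zero]
      exact mul_nonneg (mul_nonneg hγρ (Real.exp_nonneg _)) hB
  rw [e]
  calc |∑ j ∈ s, S⁻¹ x j * μ j| ≤ ∑ j ∈ s, |S⁻¹ x j * μ j| := Finset.abs_sum_le_sum_abs _ _
    _ ≤ ∑ j ∈ s, (γ - ρ)⁻¹ * Real.exp (-(κ * g.dist (blk x) y')) * B := Finset.sum_le_sum hterm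
    _ = (s.card : ℝ) * ((γ - ρ)⁻¹ * Real.exp (-(κ * g.dist (blk x) y')) * B) := by
        rw [Finset.sum_const, nsmul_eq_mul]
    _ ≤ (N : ℝ) * ((γ - ρ)⁻¹ * Real.exp (-(κ * g.dist (blk x) y')) * B) :=
        mul_le_mul_of_nonneg_right (by exact_mod_cast hs)
          (mul_nonneg (mul_nonneg hγρ (Real.exp_nonneg _)) hB)
    _ = N * (γ - ρ)⁻¹ * Real.exp (-(κ * g.dist (blk x) y')) * B := by ring

/-- **THE SAME WITH THE ENTRY DECAY READ OFF A BLOCK MAJORANT OF `S`**: if `S` (as `S.toLin'`) has the block majorant `Ce^{−δd}`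
between the sharp-block sup sizes (`C ≥ 0`) and is `γ`-coercive, then — with `N`, `σ`, `c`, `κ`, `τ`, `ρ` as in
`hasMaj_inv_of_coercive_decay` — `S⁻¹` has the block majorant `N(γ − ρ)⁻¹e^{−κd}`: the letter `hInv₀` of
`Beta.RemainderOriginTwoLetters.ineq190_origin_of_two_letters` on this carrier FROM the letter of `QG₀Q*` (§4) and the coercivity
constant alone. [cite: Balaban1985BackgroundPropagators, (3.132) p.422, Thm 3.3 p.399; Balaban1985Variational, (129)–(130) p.297; Balaban1984PropagatorsII, (2.51)–(2.54) pp.232–233, Lemma 2.1 (2.61) p.234; CombesThomas1973, §II] -/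
theorem hasMaj_inv_of_coercive_hasMaj (blk : n → g.Site) (S : Matrix n n ℝ) {γ C δ κ τ σ c ρ : ℝ} {N : ℕ}
    (hd : ∀ a b : g.Site, 0 ≤ g.dist a b) (hds : ∀ a b : g.Site, g.dist a b = g.dist b a)
    (hd0 : ∀ a : g.Site, g.dist a a = 0) (htri : Triangle254 g) (hrow : RowSum g σ c)
    (hC : 0 ≤ C) (hκ : 0 ≤ κ) (hτ : 0 < τ) (hrate : κ + τ + σ ≤ δ)
    (hN : ∀ y : g.Site, ∃ s : Finset n, s.card ≤ N ∧ ∀ j, blk j = y → j ∈ s)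
    (hco : QGQInverse.Coercive S γ)
    (hS : HasMaj (BlockNorm.ofBlocks g blk) (BlockNorm.ofBlocks g blk) (Matrix.toLin' S)
      (fun a b => C * Real.exp (-(δ * g.dist a b))))
    (hρ : ρ = C * κ / τ * N * c) (hργ : ρ < γ) :
    HasMaj (BlockNorm.ofBlocks g blk) (BlockNorm.ofBlocks g blk) (Matrix.toLin' S⁻¹)
      (fun a b => N * (γ - ρ)⁻¹ * Real.exp (-(κ * g.dist a b))) :=
  hasMaj_inv_of_coercive_decay blk S hd hds hd0 htri hrow hC hκ hτ hrate hN hco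
    (abs_entry_le_of_hasMaj blk S (fun _ _ => mul_nonneg hC (Real.exp_nonneg _)) hS) hρ hργ

end Inverse

/-! ## §4  The block majorant of `QG₀Q*` from Thm 3.3 for `G₀` and the locality of `Q`, `Q*` -/

section QGQ

variable {FA F3 FQ : Type} [AddCommGroup FA] [Module ℝ FA] [AddCommGroup F3] [Module ℝ F3]
  [AddCommGroup FQ] [Module ℝ FQ]

/-- **`QG₀Q*` INHERITS THE FIRST ENTRY OF `G₀`** (abstract block-normed spaces): `G₀ : F3 → FA` of majorant `Be^{−δ₁d}` ([5] Thm 3.3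
(3.42), first entry, for `Δ_a⁻¹` — p. 297 of [15]), `Q* : FQ → F3` LOCAL (range `r_Q`, column sums `ν_{Q*}`; `bQ′ → b3`) and
`Q : FA → FQ` LOCAL (range `r_Q`, row sums `ν_Q ≥ 0`; `bN → bQ`) ⟹ `QG₀Q* : FQ → FQ` has the majorant
`κ₃·(κ_NBν_Qe^{δ₁r_Q})·ν_{Q*}e^{δ₁r_Q}·e^{−δ₁d}` from `bQ′` into `bQ` — no rate lost (`B11Reparam190.hasMaj_comp_localLeft` ∕
`…Right`).  On the concrete carrier of §3 (`bQ = bQ′ =` the sharp-block sup sizes, `κ = 1`) this is the input `hS` of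
`hasMaj_inv_of_coercive_hasMaj`. [cite: Balaban1985BackgroundPropagators, Thm 3.3 (3.42) p.397+p.399, (3.132) p.422; Balaban1985Variational, (129) p.297; Balaban1984PropagatorsII, (2.51)–(2.56) pp.232–233] -/
theorem hasMaj_qgq_of_letters {b3 : BlockNorm g F3} {bN : BlockNorm g FA} {bQ bQ' : BlockNorm g FQ}
    {G0 : F3 →ₗ[ℝ] FA} {Q : FA →ₗ[ℝ] FQ} {Qs : FQ →ₗ[ℝ] F3} {KQ KQs : g.Site → g.Site → ℝ} {B δ₁ rQ νQ νs : ℝ}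
    (htri : Triangle254 g) (hB : 0 ≤ B) (hδ₁ : 0 ≤ δ₁) (hνQ : 0 ≤ νQ)
    (hG0 : HasMaj b3 bN G0 (fun a b => B * Real.exp (-(δ₁ * g.dist a b))))
    (hKQ : ∀ a b, 0 ≤ KQ a b) (hQloc : ∀ a b, KQ a b ≠ 0 → g.dist a b ≤ rQ)
    (hQrow : ∀ a, ∑ b : g.Site, KQ a b ≤ νQ) (hQ : HasMaj bN bQ Q KQ)
    (hKQs : ∀ a b, 0 ≤ KQs a b) (hQsloc : ∀ a b, KQs a b ≠ 0 → g.dist a b ≤ rQ)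
    (hQscol : ∀ b, ∑ a : g.Site, KQs a b ≤ νs) (hQs : HasMaj bQ' b3 Qs KQs) :
    HasMaj bQ' bQ ((Q ∘ₗ G0) ∘ₗ Qs)
      (fun a b => b3.κ * (bN.κ * B * νQ * Real.exp (δ₁ * rQ)) * νs * Real.exp (δ₁ * rQ) *
        Real.exp (-(δ₁ * g.dist a b))) := by
  -- QG₀ : b3 → bQ (local factor on the left: no rate lost)
  have h1 : HasMaj b3 bQ (Q ∘ₗ G0)
      (fun a b => bN.κ * B * νQ * Real.exp (δ₁ * rQ) * Real.exp (-(δ₁ * g.dist a b))) :=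
    hasMaj_comp_localLeft htri hB hδ₁ hKQ hQloc hQrow hQ hG0
  have ha₁ : 0 ≤ bN.κ * B * νQ * Real.exp (δ₁ * rQ) :=
    mul_nonneg (mul_nonneg (mul_nonneg bN.κ_nonneg hB) hνQ) (Real.exp_nonneg _)
  -- (QG₀)Q* : bQ′ → bQ (local factor on the right)
  exact hasMaj_comp_localRight htri ha₁ hδ₁ hKQs hQsloc hQscol h1 hQs

end QGQ

/-! ## §5  The row's letter `hInv₀` from `hG0` and ONE coercivity constant (the composition §4 → §1 → §3) -/

section Composite

variable {n : Type} [Fintype n] [DecidableEq n]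
  {FA F3 : Type} [AddCommGroup FA] [Module ℝ FA] [AddCommGroup F3] [Module ℝ F3]

/-- **`hInv₀` FROM [5] THM 3.3 FOR `G₀` AND THE COERCIVITY OF `QG₀Q*`.**  `Q`-images = real functions on the finite index set `n`
with the sharp-block sup sizes of `blk : n → 𝔅` (at most `N` indices per block); fields `FA` (size `bN`) and sources `F3` (size
`b3`) abstract.  GIVEN `hG0` (`G₀ : F3 → FA` of majorant `Be^{−δ₁d}` — Thm 3.3 (3.42), first entry, for `Δ_a⁻¹`), `Q : FA → (n → ℝ)`
and `Q* : (n → ℝ) → F3` LOCAL (range `r_Q`, row sums `ν_Q` ∕ column sums `ν_{Q*}`), the pseudo-metric bookkeeping of `𝔅` with the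
row sum (2.61) at the rate `σ`, rates `κ ≥ 0`, `τ > 0`, `κ + τ + σ ≤ δ₁`, and the matrix `S = toMatrix′(QG₀Q*)` `γ`-COERCIVE with
`ρ := C_Sκτ⁻¹Nc < γ`, `C_S = κ₃(κ_NBν_Qe^{δ₁r_Q})ν_{Q*}e^{δ₁r_Q}`: THEN `S⁻¹ = (QG₀Q*)⁻¹` has the block majorant `N(γ − ρ)⁻¹e^{−κd}`
— the (3.132)-SHAPE letter `hInv₀` of `Beta.RemainderOriginBaseLetters.hasMaj_H0_of_base_letters` ∕ the two-letter END, with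
`B_I = N(γ − ρ)⁻¹`, `δ_I = κ`.  Nothing of [5] is proved: Thm 3.3 and the coercivity stay hypotheses.
[cite: Balaban1985BackgroundPropagators, (3.132) p.422, Thm 3.3 (3.42) p.397+p.399; Balaban1985Variational, (129)–(130) p.297; Balaban1984PropagatorsII, (2.51)–(2.54) pp.232–233, Lemma 2.1 (2.61) p.234; CombesThomas1973, §II] -/
theorem hasMaj_invQGQ_of_coercive (blk : n → g.Site) {b3 : BlockNorm g F3} {bN : BlockNorm g FA}
    {G0 : F3 →ₗ[ℝ] FA} {Q : FA →ₗ[ℝ] (n → ℝ)} {Qs : (n → ℝ) →ₗ[ℝ] F3} {S : Matrix n n ℝ}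
    {KQ KQs : g.Site → g.Site → ℝ} {γ B δ₁ κ τ σ c rQ νQ νs CS ρ : ℝ} {N : ℕ}
    (hd : ∀ a b : g.Site, 0 ≤ g.dist a b) (hds : ∀ a b : g.Site, g.dist a b = g.dist b a)
    (hd0 : ∀ a : g.Site, g.dist a a = 0) (htri : Triangle254 g) (hrow : RowSum g σ c)
    (hB : 0 ≤ B) (hνQ : 0 ≤ νQ) (hνs : 0 ≤ νs) (hκ : 0 ≤ κ) (hτ : 0 < τ) (hσ : 0 ≤ σ) (hrate : κ + τ + σ ≤ δ₁)
    (hN : ∀ y : g.Site, ∃ s : Finset n, s.card ≤ N ∧ ∀ j, blk j = y → j ∈ s)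
    (hG0 : HasMaj b3 bN G0 (fun a b => B * Real.exp (-(δ₁ * g.dist a b))))
    (hKQ : ∀ a b, 0 ≤ KQ a b) (hQloc : ∀ a b, KQ a b ≠ 0 → g.dist a b ≤ rQ)
    (hQrow : ∀ a, ∑ b : g.Site, KQ a b ≤ νQ) (hQ : HasMaj bN (BlockNorm.ofBlocks g blk) Q KQ)
    (hKQs : ∀ a b, 0 ≤ KQs a b) (hQsloc : ∀ a b, KQs a b ≠ 0 → g.dist a b ≤ rQ)
    (hQscol : ∀ b, ∑ a : g.Site, KQs a b ≤ νs) (hQs : HasMaj (BlockNorm.ofBlocks g blk) b3 Qs KQs)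
    (hSdef : S = LinearMap.toMatrix' ((Q ∘ₗ G0) ∘ₗ Qs)) (hco : QGQInverse.Coercive S γ)
    (hCS : CS = b3.κ * (bN.κ * B * νQ * Real.exp (δ₁ * rQ)) * νs * Real.exp (δ₁ * rQ))
    (hρ : ρ = CS * κ / τ * N * c) (hργ : ρ < γ) :
    HasMaj (BlockNorm.ofBlocks g blk) (BlockNorm.ofBlocks g blk) (Matrix.toLin' S⁻¹)
      (fun a b => N * (γ - ρ)⁻¹ * Real.exp (-(κ * g.dist a b))) := by
  have hδ₁ : 0 ≤ δ₁ := by linarith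
  -- §4: the block majorant of QG₀Q* = toLin' S
  have hS : HasMaj (BlockNorm.ofBlocks g blk) (BlockNorm.ofBlocks g blk) (Matrix.toLin' S)
      (fun a b => CS * Real.exp (-(δ₁ * g.dist a b))) := by
    rw [hSdef, Matrix.toLin'_toMatrix', hCS]
    exact hasMaj_qgq_of_letters htri hB hδ₁ hνQ hG0 hKQ hQloc hQrow hQ hKQs hQsloc hQscol hQs
  have hCS0 : 0 ≤ CS := by
    rw [hCS]
    have := b3.κ_nonneg; have := bN.κ_nonneg
    positivity
  -- §1 + §3
  exact hasMaj_inv_of_coercive_hasMaj blk S hd hds hd0 htri hrow hCS0 hκ hτ hrate hN hco hS hρ hργ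

end Composite

end Literature.MathematicalPhysics.QuantumFieldTheory.Balaban1983to89.Beta.RemainderInvQGQCoercive
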